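import Summits.HodgeConjecture.HodgeConjecture.Theorems.R90S3TransportPrincipalSeries
import Literature.NumberTheory.Automorphic.IrreducibleClassesBoxChar
import Literature.NumberTheory.Automorphic.SmoothCharacterOfCharacter
import Literature.NumberTheory.Automorphic.TorusCharacterLocalComponents
import HarnessLib

/-!
# R90 · S3 · FILE G brick G3c — the (13.8.5) TYPE-4 datum `ρ = O ⊠ χ` (a `U(2)`-packet cut out by a quadratic-extension principal series) is transported

R90-TF SLAB, section S3 (Rogawski Ch. 13.2 «Endo-H»), dealer R90-C12-plan (g2) «BUNDLE 1»; seat K2E3-p36 (g3); crux H413 =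
`stmt-HodgeConjecture-24833`, route `HCCMUnconditional`, lane `--supports … --as helper` (count-neutral).  PAYS, IN NAME-SHAPE (statement = the socket
body of `Cruxes/H413/Lines/R90_S3_LocalTransportWaveG.lean` :308, ED. 3 7e1bdc0be15c4802, VERBATIM incl. binders; the next G edition closes it by
`exact`): G3c `stub_R90_S3_transport_rhoPacket` ← `rhoPacket_transport`.  Along `(Φ, e₂, e₁, e_H)`: the `U(Φ₂)`-packet `O = JH(i(torusCharPair 0 χ₁ χ₂))`
goes to `O′ := e₂∗O` (★ `IrrClass.comapEquiv e₂.symm`), the box character to `χ′ := χ ∘ e₁⁻¹`, the quadratic character extension `(χ₁, χ₂)` of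
`(E_v^×, E¹_v)` to `(χ₁ ∘ Φ⁻¹, χ₂ ∘ Φ⁻¹)` on `(E′^×_{v′}, E′¹_{v′})` (`Φ⁻¹` maps norm-one units to norm-one units because it intertwines the involutions,
`hΦσ`), and then (i) `IsQuadraticCharExtension` is transported (norms `ȳ y` correspond under `Φ`), (ii) `O′ = JH(i(torusCharPair 0 χ₁′ χ₂′))` by the kit
★ `R90S3TransportPrincipalSeries.comap_symm_isConstituentOf_cmPrincipalSeries_iff` — the torus characters match along `e₂` since the `(0,0)` entry and
the determinant of `e₂ t = Φ(t)` are `Φ` of those of `t` (kit `transport_apply_apply`, `coe_transport_apply`, `RingEquiv.map_det`), (iii) `(O ⊠ χ) ∘ e_H⁻¹ =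
O′ ⊠ χ′` classwise (`comap_boxChar_eq`: the identity of the space intertwines, `heH`).  One direction (the converse is the socket at the reversed datum);
dead frame binders `_hc _hc' _hΦμ _he₁` carried.  ★-ONLY IMPORTS; theorems only (no `def`, no instance, no notation, no `sorry`); NOT a print input.

HONEST LABEL: HC_CM is proved only modulo the 7 printed citations (2 remaining named inputs: hLiu418 = stmt-HodgeConjecture-24832,
h413 = stmt-HodgeConjecture-24833) until rung 0 closes; pure transport of structure; pays G3c only when ★ AND the next G edition plugs it and is BUILT;
G is off the rung-0 path except via S10's file U.  REL ≠ ★ ≠ BUILT.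

## References
* [Rogawski1990] J. D. Rogawski, *Automorphic Representations of Unitary Groups in Three Variables*, Ann. of Math. Stud. 123 (1990), §11.1 p. 161
  (packets of `U(2)`), §12.1 pp. 171–172 (`ρ = ρ₁ ⊗ χ`, `χ = (χ₁, χ₂)`), §13.8 (13.8.5) p. 219 (type 4), §14.2 p. 232.
* [BernsteinZelevinsky1977] I. N. Bernstein, A. V. Zelevinsky, Ann. Sci. ÉNS 10 (1977), §2.3 · [BushnellHenniart2006] §1.1, §9.1.
-/

set_option autoImplicit false
-- the mandated namespace repeats the single-problem summit's segment (`HodgeConjecture.HodgeConjecture`)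
set_option linter.dupNamespace false

noncomputable section

open NumberField IsDedekindDomain
open scoped Matrix MatrixGroups
open Literature.NumberTheory.Automorphic Literature.NumberTheory.Automorphic.UnitaryGroup Literature.NumberTheory.GaloisRepresentations

namespace Summit.HodgeConjecture.HodgeConjecture.R90.S3

/-! ## §0 `(r ⊠ χ) ∘ e_H⁻¹ = (r ∘ e₂⁻¹) ⊠ (χ ∘ e₁⁻¹)` for `e_H = e₂ × e₁` -/

/-- **Box and pull-back commute**: for isomorphisms `e₂ : A ≃ₜ* A′`, `e₁ : B ≃ₜ* B′` and `e_H : A × B ≃ₜ* A′ × B′` with `e_H = e₂ × e₁`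
pointwise (`heH`), and a smooth character `χ` of `B`, the class `(c ⊠ χ) ∘ e_H⁻¹` is `(c ∘ e₂⁻¹) ⊠ (χ ∘ e₁⁻¹)` (★ `IrrClass.boxChar`, ★ `IrrClass.comap`;
the identity of the space intertwines, since `e_H⁻¹(a′, b′) = (e₂⁻¹ a′, e₁⁻¹ b′)`). [cite: BushnellHenniart2006, §9.1] [cite: Rogawski1990, §12.1 p. 171] -/
theorem comap_boxChar_eq {A A' B B' : Type} [Group A] [TopologicalSpace A] [IsTopologicalGroup A] [Group A'] [TopologicalSpace A']
    [IsTopologicalGroup A'] [Group B] [TopologicalSpace B] [IsTopologicalGroup B] [Group B'] [TopologicalSpace B'] [IsTopologicalGroup B']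
    (e₂ : A ≃ₜ* A') (e₁ : B ≃ₜ* B') (eH : A × B ≃ₜ* A' × B') (heH : ∀ h, eH h = (e₂ h.1, e₁ h.2))
    (χ : B →* ℂˣ) (hχ : IsOpen ((χ.ker : Subgroup B) : Set B))
    (hχ' : IsOpen (((χ.comp (e₁.symm : B' →* B)).ker : Subgroup B') : Set B')) (c : IrrClass A) :
    IrrClass.comap eH.symm (IrrClass.boxChar χ hχ c) = IrrClass.boxChar (χ.comp (e₁.symm : B' →* B)) hχ' (IrrClass.comap e₂.symm c) := by
  obtain ⟨r, rfl⟩ := IrrClass.mk_surjective c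
  rw [IrrClass.boxChar_mk, IrrClass.comap_mk, IrrClass.comap_mk, IrrClass.boxChar_mk]
  refine IrrClass.mk_eq_mk_of_equiv (Representation.Equiv.mk (LinearEquiv.refl ℂ r.V) fun h' => LinearMap.ext fun x => ?_)
  have hsymm : eH.symm h' = (e₂.symm h'.1, e₁.symm h'.2) := by
    apply eH.injective
    rw [ContinuousMulEquiv.apply_symm_apply, heH, ContinuousMulEquiv.apply_symm_apply, ContinuousMulEquiv.apply_symm_apply]
  change (((χ (eH.symm h').2 : ℂˣ) : ℂ) • r.ρ (eH.symm h').1 x : r.V) = ((χ (e₁.symm h'.2) : ℂˣ) : ℂ) • r.ρ (e₂.symm h'.1) x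
  rw [hsymm]

section Brick

variable (L : Type) [Field L] [NumberField L] [IsCMField L] (v : HeightOneSpectrum (𝓞 ↥(maximalRealSubfield L)))

/-! ## §1 G3c — the TYPE-4 datum is transported -/

set_option maxHeartbeats 4000000 in
/-- **G3c `stub_R90_S3_transport_rhoPacket` IN NAME-SHAPE — the (13.8.5) TYPE-4 datum is transported.**  Given `ρ = O ⊠ χ` with `O` the set of
constituents of the principal series `i(torusCharPair 0 χ₁ χ₂)` of `U(Φ₂)(L⁺_v)` cut out by a quadratic character extension `(χ₁, χ₂)` (`χ₁|F^× = ω`),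
the transported set `ρ ∘ e_H⁻¹` is `O′ ⊠ χ′` for `O′ := e₂∗O`, `χ′ := χ ∘ e₁⁻¹`, and `O′` is the set of constituents of `i(torusCharPair 0 χ₁′ χ₂′)` for the
transported extension `χ₁′ := χ₁ ∘ Φ⁻¹`, `χ₂′ := χ₂ ∘ Φ⁻¹|_{E′¹}` — which is again a quadratic character extension (norms correspond under `Φ`, `hΦσ`).  WHY:
`i(χ_T) ≅ i(χ_T′) ∘ e₂` for `χ_T′(e₂ t) = χ_T(t)` (kit `comap_symm_isConstituentOf_cmPrincipalSeries_iff`; the `(0,0)` entry and the determinant of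
`e₂ t` are `Φ` of those of `t`), and `(O ⊠ χ) ∘ e_H⁻¹ = (e₂∗O) ⊠ (χ ∘ e₁⁻¹)` classwise (§0).  Statement = socket G3c of `Lines/R90_S3_LocalTransportWaveG.lean`
:308 VERBATIM (dead frame binders `_hc _hc' _hΦμ _he₁` carried); NOT a print input.
[cite: Rogawski1990, §11.1 p. 161; §12.1 pp. 171–172; §13.8 p. 219; §14.2 p. 232] [cite: BernsteinZelevinsky1977, §2.3] -/
theorem rhoPacket_transport
    (L' : Type) [Field L'] [NumberField L'] [IsCMField L'] (v' : HeightOneSpectrum (𝓞 ↥(maximalRealSubfield L')))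
    (Φ : UnitaryGroup.LocalRing L v ≃+* UnitaryGroup.LocalRing L' v') (_hc : Continuous Φ) (_hc' : Continuous Φ.symm)
    (hΦσ : ∀ x, Φ ((conjLocal L (IsCMField.complexConj L) v) x) = (conjLocal L' (IsCMField.complexConj L') v') (Φ x))
    (μ : HeckeCharacter L) (μ' : HeckeCharacter L')
    (_hΦμ : ∀ u : (UnitaryGroup.LocalRing L v)ˣ,
      μ'.semilocalComponent L' v' (Units.map (Φ : UnitaryGroup.LocalRing L v →+* UnitaryGroup.LocalRing L' v').toMonoidHom u) = μ.semilocalComponent L v u)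
    (e₂ : (UnitaryGroup.cmDatum L 2 (Matrix.of fun i j : Fin 2 => if i.val + j.val + 1 = 2 then (1 : L) else 0)).Local v ≃ₜ*
      (UnitaryGroup.cmDatum L' 2 (Matrix.of fun i j : Fin 2 => if i.val + j.val + 1 = 2 then (1 : L') else 0)).Local v')
    (he₂ : ∀ g, ((e₂ g).val : GL (Fin 2) (UnitaryGroup.LocalRing L' v')) = Matrix.GeneralLinearGroup.map (Φ : UnitaryGroup.LocalRing L v →+* UnitaryGroup.LocalRing L' v') (g.val : GL (Fin 2) (UnitaryGroup.LocalRing L v)))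
    (e₁ : (UnitaryGroup.cmDatum L 1 (Matrix.of fun i j : Fin 1 => if i.val + j.val + 1 = 1 then (1 : L) else 0)).Local v ≃ₜ*
      (UnitaryGroup.cmDatum L' 1 (Matrix.of fun i j : Fin 1 => if i.val + j.val + 1 = 1 then (1 : L') else 0)).Local v')
    (_he₁ : ∀ g, ((e₁ g).val : GL (Fin 1) (UnitaryGroup.LocalRing L' v')) = Matrix.GeneralLinearGroup.map (Φ : UnitaryGroup.LocalRing L v →+* UnitaryGroup.LocalRing L' v') (g.val : GL (Fin 1) (UnitaryGroup.LocalRing L v)))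
    (eH : ((UnitaryGroup.cmDatum L 2 (Matrix.of fun i j : Fin 2 => if i.val + j.val + 1 = 2 then (1 : L) else 0)).Local v ×
      (UnitaryGroup.cmDatum L 1 (Matrix.of fun i j : Fin 1 => if i.val + j.val + 1 = 1 then (1 : L) else 0)).Local v) ≃ₜ*
      ((UnitaryGroup.cmDatum L' 2 (Matrix.of fun i j : Fin 2 => if i.val + j.val + 1 = 2 then (1 : L') else 0)).Local v' ×
      (UnitaryGroup.cmDatum L' 1 (Matrix.of fun i j : Fin 1 => if i.val + j.val + 1 = 1 then (1 : L') else 0)).Local v'))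
    (heH : ∀ h, eH h = (e₂ h.1, e₁ h.2))
    (ρ : Finset (IrrClass ((UnitaryGroup.cmDatum L 2 (Matrix.of fun i j : Fin 2 => if i.val + j.val + 1 = 2 then (1 : L) else 0)).Local v ×
      (UnitaryGroup.cmDatum L 1 (Matrix.of fun i j : Fin 1 => if i.val + j.val + 1 = 1 then (1 : L) else 0)).Local v)))
    (O : Finset (IrrClass ((UnitaryGroup.cmDatum L 2 (Matrix.of fun i j : Fin 2 => if i.val + j.val + 1 = 2 then (1 : L) else 0)).Local v)))
    (χ : (UnitaryGroup.cmDatum L 1 (Matrix.of fun i j : Fin 1 => if i.val + j.val + 1 = 1 then (1 : L) else 0)).Local v →* ℂˣ)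
    (hχ : IsOpen ((χ.ker : Subgroup ((UnitaryGroup.cmDatum L 1 (Matrix.of fun i j : Fin 1 => if i.val + j.val + 1 = 1 then (1 : L) else 0)).Local v)) : Set ((UnitaryGroup.cmDatum L 1 (Matrix.of fun i j : Fin 1 => if i.val + j.val + 1 = 1 then (1 : L) else 0)).Local v)))
    (χ₁ : (UnitaryGroup.LocalRing L v)ˣ →* ℂˣ) (χ₂ : ↥(normOneUnits (conjLocal L (IsCMField.complexConj L) v)) →* ℂˣ)
    (hq : IsQuadraticCharExtension (conjLocal L (IsCMField.complexConj L) v) χ₁)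
    (hO : ∀ c : IrrClass ((UnitaryGroup.cmDatum L 2 (Matrix.of fun i j : Fin 2 => if i.val + j.val + 1 = 2 then (1 : L) else 0)).Local v), c ∈ O ↔
      c.IsConstituentOf (cmPrincipalSeries L 2 v (torusCharPair (conjLocal L (IsCMField.complexConj L) v) (cmLocalForm L 2 v) (cmLocalForm_eq_over L 2 v) 0 χ₁ χ₂)))
    (hρ : ρ = O.map ⟨IrrClass.boxChar χ hχ, IrrClass.boxChar_injective χ hχ⟩) :
    ∃ (O' : Finset (IrrClass ((UnitaryGroup.cmDatum L' 2 (Matrix.of fun i j : Fin 2 => if i.val + j.val + 1 = 2 then (1 : L') else 0)).Local v')))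
      (χ' : (UnitaryGroup.cmDatum L' 1 (Matrix.of fun i j : Fin 1 => if i.val + j.val + 1 = 1 then (1 : L') else 0)).Local v' →* ℂˣ)
      (hχ' : IsOpen ((χ'.ker : Subgroup ((UnitaryGroup.cmDatum L' 1 (Matrix.of fun i j : Fin 1 => if i.val + j.val + 1 = 1 then (1 : L') else 0)).Local v')) : Set ((UnitaryGroup.cmDatum L' 1 (Matrix.of fun i j : Fin 1 => if i.val + j.val + 1 = 1 then (1 : L') else 0)).Local v')))
      (χ₁' : (UnitaryGroup.LocalRing L' v')ˣ →* ℂˣ) (χ₂' : ↥(normOneUnits (conjLocal L' (IsCMField.complexConj L') v')) →* ℂˣ),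
      IsQuadraticCharExtension (conjLocal L' (IsCMField.complexConj L') v') χ₁' ∧
      (∀ c : IrrClass ((UnitaryGroup.cmDatum L' 2 (Matrix.of fun i j : Fin 2 => if i.val + j.val + 1 = 2 then (1 : L') else 0)).Local v'), c ∈ O' ↔
        c.IsConstituentOf (cmPrincipalSeries L' 2 v' (torusCharPair (conjLocal L' (IsCMField.complexConj L') v') (cmLocalForm L' 2 v') (cmLocalForm_eq_over L' 2 v') 0 χ₁' χ₂'))) ∧
      ρ.map (IrrClass.comapEquiv eH.symm).toEmbedding = O'.map ⟨IrrClass.boxChar χ' hχ', IrrClass.boxChar_injective χ' hχ'⟩ := by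
  -- (0) `Φ⁻¹` intertwines the involutions; `Φ⁻¹` carries `E′¹_{v′}` into `E¹_v`
  have hΦσ' : ∀ y, Φ.symm ((conjLocal L' (IsCMField.complexConj L') v') y) = (conjLocal L (IsCMField.complexConj L) v) (Φ.symm y) :=
    fun y => Φ.injective (by rw [Φ.apply_symm_apply, hΦσ, Φ.apply_symm_apply])
  have hν : ∀ x' : (UnitaryGroup.LocalRing L' v')ˣ, x' ∈ normOneUnits (conjLocal L' (IsCMField.complexConj L') v') →
      Units.map (Φ.symm : UnitaryGroup.LocalRing L' v' →+* UnitaryGroup.LocalRing L v).toMonoidHom x' ∈ normOneUnits (conjLocal L (IsCMField.complexConj L) v) := by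
    intro x' hx'
    rw [mem_normOneUnits_iff] at hx' ⊢
    change (conjLocal L (IsCMField.complexConj L) v) (Φ.symm (x' : UnitaryGroup.LocalRing L' v')) * Φ.symm (x' : UnitaryGroup.LocalRing L' v') = 1
    rw [← hΦσ', ← map_mul, hx', map_one]
  -- (1) the witnesses `χ′ := χ ∘ e₁⁻¹`, `χ₁′ := χ₁ ∘ Φ⁻¹`, `χ₂′ := χ₂ ∘ Φ⁻¹|_{E′¹}` and the torus characters `χ_T`, `χ_T′`
  let χ' : (UnitaryGroup.cmDatum L' 1 (Matrix.of fun i j : Fin 1 => if i.val + j.val + 1 = 1 then (1 : L') else 0)).Local v' →* ℂˣ := χ.comp (e₁.symm : (UnitaryGroup.cmDatum L' 1 (Matrix.of fun i j : Fin 1 => if i.val + j.val + 1 = 1 then (1 : L') else 0)).Local v' →* (UnitaryGroup.cmDatum L 1 (Matrix.of fun i j : Fin 1 => if i.val + j.val + 1 = 1 then (1 : L) else 0)).Local v)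
  let φu : (UnitaryGroup.LocalRing L' v')ˣ →* (UnitaryGroup.LocalRing L v)ˣ := (Units.map (Φ.symm : UnitaryGroup.LocalRing L' v' →+* UnitaryGroup.LocalRing L v).toMonoidHom)
  let ν : ↥(normOneUnits (conjLocal L' (IsCMField.complexConj L') v')) →* ↥(normOneUnits (conjLocal L (IsCMField.complexConj L) v)) :=
    (φu.comp (normOneUnits (conjLocal L' (IsCMField.complexConj L') v')).subtype).codRestrict _ fun x' => hν x'.1 x'.2
  let χT := torusCharPair (conjLocal L (IsCMField.complexConj L) v) (cmLocalForm L 2 v) (cmLocalForm_eq_over L 2 v) 0 χ₁ χ₂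
  let χT' := torusCharPair (conjLocal L' (IsCMField.complexConj L') v') (cmLocalForm L' 2 v') (cmLocalForm_eq_over L' 2 v') 0
    (χ₁.comp φu) (χ₂.comp ν)
  -- (2) the torus characters match along `e₂` (the `(0,0)` entry and the determinant of `e₂ t = Φ(t)` are `Φ` of those of `t`), so the kit applies
  have key : ∀ c : IrrClass ((UnitaryGroup.cmDatum L 2 (Matrix.of fun i j : Fin 2 => if i.val + j.val + 1 = 2 then (1 : L) else 0)).Local v),
      (IrrClass.comap e₂.symm c).IsConstituentOf (cmPrincipalSeries L' 2 v' χT') ↔ c.IsConstituentOf (cmPrincipalSeries L 2 v χT) := by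
    refine fun c => comap_symm_isConstituentOf_cmPrincipalSeries_iff L v L' v' Φ e₂ he₂ χT χT' (fun t ht => ?_) c
    change χ₁ (φu _) * χ₂ (ν _) = χ₁ _ * χ₂ _
    congr 2
    · refine Units.ext ?_
      simp only [φu, Units.coe_map, RingHom.toMonoidHom_eq_coe, MonoidHom.coe_coe, RingEquiv.coe_toRingHom, coe_torusEntry]
      rw [transport_apply_apply L v L' v' Φ e₂ he₂, RingEquiv.symm_apply_apply]
    · refine Subtype.ext (Units.ext ?_)
      simp only [ν, φu, MonoidHom.codRestrict_apply, MonoidHom.comp_apply, Subgroup.coe_subtype, Units.coe_map, RingHom.toMonoidHom_eq_coe,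
        MonoidHom.coe_coe, RingEquiv.coe_toRingHom, coe_torusDetNormOne, coe_torusDet, Subgroup.coe_mk]
      rw [coe_transport_apply L v L' v' Φ e₂ he₂, ← RingEquiv.mapMatrix_apply, ← RingEquiv.map_det, RingEquiv.symm_apply_apply]
  refine ⟨O.map (IrrClass.comapEquiv e₂.symm).toEmbedding, χ',
    (by rw [← MonoidHom.comap_ker, Subgroup.coe_comap]; exact hχ.preimage e₁.symm.continuous), χ₁.comp φu, χ₂.comp ν, ?_, ?_, ?_⟩
  · -- (i) `χ₁ ∘ Φ⁻¹` on `F′^×_{v′}` is the quadratic character of `E′/F′`: norms `ȳ y` correspond under `Φ`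
    intro x' hx'
    have hx : (conjLocal L (IsCMField.complexConj L) v) ((φu x' : (UnitaryGroup.LocalRing L v)ˣ) : UnitaryGroup.LocalRing L v) = (φu x' : (UnitaryGroup.LocalRing L v)ˣ) := by
      change (conjLocal L (IsCMField.complexConj L) v) (Φ.symm (x' : UnitaryGroup.LocalRing L' v')) = Φ.symm (x' : UnitaryGroup.LocalRing L' v')
      rw [← hΦσ', hx']
    rw [MonoidHom.comp_apply, hq _ hx]
    constructor
    · rintro ⟨y, hy⟩
      refine ⟨Units.map (Φ : UnitaryGroup.LocalRing L v →+* UnitaryGroup.LocalRing L' v').toMonoidHom y, ?_⟩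
      have hy' : (conjLocal L (IsCMField.complexConj L) v) (y : UnitaryGroup.LocalRing L v) * (y : UnitaryGroup.LocalRing L v) = Φ.symm (x' : UnitaryGroup.LocalRing L' v') := hy
      change (conjLocal L' (IsCMField.complexConj L') v') (Φ (y : UnitaryGroup.LocalRing L v)) * Φ (y : UnitaryGroup.LocalRing L v) = (x' : UnitaryGroup.LocalRing L' v')
      rw [← hΦσ, ← map_mul, hy', Φ.apply_symm_apply]
    · rintro ⟨y', hy'⟩
      refine ⟨φu y', ?_⟩
      change (conjLocal L (IsCMField.complexConj L) v) (Φ.symm (y' : UnitaryGroup.LocalRing L' v')) * Φ.symm (y' : UnitaryGroup.LocalRing L' v') = Φ.symm (x' : UnitaryGroup.LocalRing L' v')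
      rw [← hΦσ', ← map_mul, hy']
  · -- (ii) `e₂∗O = JH(i(χ_T′))`
    intro c'
    rw [Finset.mem_map]
    constructor
    · rintro ⟨c, hc, rfl⟩
      exact (key c).2 ((hO c).1 hc)
    · intro h
      refine ⟨IrrClass.comap e₂ c', (hO _).2 ((key (IrrClass.comap e₂ c')).1 ?_), IrrClass.comap_symm_comap e₂ c'⟩
      rwa [IrrClass.comap_symm_comap]
  · -- (iii) `(O ⊠ χ) ∘ e_H⁻¹ = (e₂∗O) ⊠ (χ ∘ e₁⁻¹)` classwise
    rw [hρ, Finset.map_map, Finset.map_map]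
    congr 1
    exact DFunLike.ext _ _ fun c => comap_boxChar_eq e₂ e₁ eH heH χ hχ _ c

end Brick

end Summit.HodgeConjecture.HodgeConjecture.R90.S3

end
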